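import Mathlib
import Summits.Ventures.PercRepro.TriangleCapVertexDecomposition

/-!
# PercRepro — THE LAYERS OF THE PAIR-COUNT SPECTRUM: EVERY TRIANGLE-FREE GRAPH SITS IN THE BAND OF ITS
MAX-DEGREE LAYER (p3, gen 50; part 217)

From the vertex decomposition `Σ d² = d(w)² + d(w) + 2 t + 2 att + P` (`t` off-edges, `att ≤ t`, `P ≤ t (t − 1)`
and `P` even — `P = Σ_{v ≠ w} c(v)(c(v) − 1)`) at a non-isolated vertex `w` of a triangle-free graph:

  **`Σ_v d(v)² + 2 t (d(w) − 1) + 2 j = s (s + 1)` for some `j ≤ t (t + 1) / 2`**   (`sum_deg_sq_layer`),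

`j = (t − att) + (t (t − 1) − P) / 2`.  At a vertex of maximum degree `Δ = s − t` this is THE LAYER THEOREM
(`pair_count_layer`): the value of `Σ d²` lies in the band `[s (s + 1) − 2 t (s − t − 1) − t (t + 1), s (s + 1) − 2 t (s − t − 1)]`
of its layer, in steps of `2` — `t = 0` the star, `t = 1` the broom (`j = 0`) or the star plus a disjoint pair
(`j = 1`), `t = 2` the band of part 213 (`j ≤ 3`), `t = 3` the band `s (s + 1) − 6 (s − 4) − 2 j`, `j ≤ 6`
(`pair_count_spectrum_three`: for `s ≥ 15` the layers `t ≤ 3` and the tail `Σ d² + 8 (s − 5) ≤ s (s + 1)` of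
`Δ ≤ s − 4` are listed and the bands do not overlap).

Axioms: standard.
-/

namespace PercRepro

namespace TriangleCap

namespace C047

open Finset

variable {V : Type*} [Fintype V] [DecidableEq V]

/-- `offAdjPairs` is even (`Σ_{v ≠ w} c(v)(c(v) − 1)`, each term even). -/
theorem offAdjPairs_even (H : SimpleGraph V) [DecidableRel H.Adj] (w : V) : Even (offAdjPairs H w) := by
  rw [← sum_erase_offDeg_mul_pred]
  apply Finset.even_sum
  intro v _
  exact Nat.even_mul_pred_self (offDeg H w v)

/-- **THE LAYER OF A VERTEX:** in a triangle-free graph, at a non-isolated vertex `w` with `t` off-edges,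
`Σ_v d(v)² + 2 t (d(w) − 1) + 2 j = s (s + 1)` for some `j ≤ t (t + 1) / 2`. -/
theorem sum_deg_sq_layer (H : SimpleGraph V) [DecidableRel H.Adj] (hfree : H.CliqueFree 3) (w : V)
    (hw : 1 ≤ deg H w) :
    ∃ j, j ≤ (offEdges H w).card * ((offEdges H w).card + 1) / 2 ∧
      ∑ v, deg H v * deg H v + 2 * ((offEdges H w).card * (deg H w - 1)) + 2 * j =
        H.edgeFinset.card * (H.edgeFinset.card + 1) := by
  have hdec := sum_deg_sq_vertex_decomposition H w
  have hcard := card_offEdges_add_deg H w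
  have hA := attach_le H hfree w
  have hP := offAdjPairs_add_le H w
  obtain ⟨q, hq⟩ := offAdjPairs_even H w
  obtain ⟨t, ht⟩ : ∃ t, (offEdges H w).card = t := ⟨_, rfl⟩
  obtain ⟨d, hd⟩ : ∃ d, deg H w = d := ⟨_, rfl⟩
  rw [ht] at hdec hcard hA hP
  rw [hd] at hdec hcard hw
  rw [ht, hd, ← hcard]
  refine ⟨(t - attach H w) + (t * t - t - 2 * q) / 2, ?_, ?_⟩
  · have h1 : t * t - t - 2 * q = 2 * ((t * t - t) / 2 - q) := by
      have ht2 : Even (t * t - t) := by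
        have : t * t - t = t * (t - 1) := by
          rcases Nat.eq_zero_or_pos t with rfl | hpos
          · rfl
          · obtain ⟨t', rfl⟩ : ∃ t', t = t' + 1 := ⟨t - 1, by omega⟩
            rw [Nat.add_sub_cancel]
            have := Nat.le_mul_self (t' + 1)
            have e : (t' + 1) * (t' + 1) = (t' + 1) * t' + (t' + 1) := by ring
            rw [e, Nat.add_sub_cancel]
        rw [this]
        exact Nat.even_mul_pred_self t
      obtain ⟨u, hu⟩ := ht2
      omega
    rw [h1, Nat.mul_div_cancel_left _ (by norm_num)]
    have h2 : t * (t + 1) / 2 = (t * t - t) / 2 + t := by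
      have e : t * (t + 1) = (t * t - t) + 2 * t := by
        have := Nat.le_mul_self t
        zify [this]
        ring
      rw [e, Nat.add_mul_div_left _ _ (by norm_num)]
    omega
  · obtain ⟨d', rfl⟩ : ∃ d', d = d' + 1 := ⟨d - 1, by omega⟩
    have e2 : d' + 1 - 1 = d' := by omega
    rw [e2]
    have h1 : t * t - t - 2 * q = 2 * ((t * t - t) / 2 - q) := by
      have ht2 : Even (t * t - t) := by
        have : t * t - t = t * (t - 1) := by
          rcases Nat.eq_zero_or_pos t with rfl | hpos
          · rfl
          · obtain ⟨t', rfl⟩ : ∃ t', t = t' + 1 := ⟨t - 1, by omega⟩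
            rw [Nat.add_sub_cancel]
            have e : (t' + 1) * (t' + 1) = (t' + 1) * t' + (t' + 1) := by ring
            rw [e, Nat.add_sub_cancel]
        rw [this]
        exact Nat.even_mul_pred_self t
      obtain ⟨u, hu⟩ := ht2
      omega
    rw [h1, Nat.mul_div_cancel_left _ (by norm_num)]
    have hle := Nat.le_mul_self t
    have e3 : (t + (d' + 1)) * (t + (d' + 1) + 1) =
        (d' + 1) * (d' + 1) + (d' + 1) + 2 * t + 2 * t + (t * t - t) + 2 * (t * d') := by
      zify [hle]
      ring
    rw [e3, hdec]
    have e4 : 2 * ((t * t - t) / 2 - q) = (t * t - t) - 2 * q := by omega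
    omega

/-- **THE LAYER THEOREM:** a triangle-free graph with at least one edge has a vertex `w` of maximum degree
`Δ = s − t` and `Σ_v d(v)² + 2 t (Δ − 1) + 2 j = s (s + 1)` for some `j ≤ t (t + 1) / 2`. -/
theorem pair_count_layer (H : SimpleGraph V) [DecidableRel H.Adj] (hfree : H.CliqueFree 3)
    (hs : 1 ≤ H.edgeFinset.card) :
    ∃ w, (∀ v, deg H v ≤ deg H w) ∧ (offEdges H w).card + deg H w = H.edgeFinset.card ∧
      ∃ j, j ≤ (offEdges H w).card * ((offEdges H w).card + 1) / 2 ∧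
        ∑ v, deg H v * deg H v + 2 * ((offEdges H w).card * (deg H w - 1)) + 2 * j =
          H.edgeFinset.card * (H.edgeFinset.card + 1) := by
  have hne : (univ : Finset V).Nonempty := by
    obtain ⟨e, he⟩ := card_pos.mp (by omega : 0 < H.edgeFinset.card)
    revert he
    refine Sym2.ind (fun x y _ => ?_) e
    exact ⟨x, mem_univ x⟩
  obtain ⟨w, -, hwmax⟩ := exists_max_image univ (deg H) hne
  have hw : 1 ≤ deg H w := by
    obtain ⟨e, he⟩ := card_pos.mp (by omega : 0 < H.edgeFinset.card)
    revert he
    refine Sym2.ind (fun x y he => ?_) e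
    have hxy : H.Adj x y := (SimpleGraph.mem_edgeSet H).mp (SimpleGraph.mem_edgeFinset.mp he)
    have hx : 1 ≤ deg H x := by
      unfold deg
      exact card_pos.mpr ⟨y, mem_filter.mpr ⟨mem_univ _, hxy⟩⟩
    exact le_trans hx (hwmax x (mem_univ x))
  exact ⟨w, fun v => hwmax v (mem_univ v), card_offEdges_add_deg H w, sum_deg_sq_layer H hfree w hw⟩

/-- **THE SPECTRUM DOWN TO THE `Δ = s − 3` LAYER** (`s ≥ 15`): the values of `Σ_v d(v)²` over the triangle-free
graphs with `s` edges are `s (s + 1)` (the star), `s (s + 1) − 2 (s − 2) − 2 j` with `j ≤ 1`, `s (s + 1) − 4 (s − 3) − 2 j`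
with `j ≤ 3`, `s (s + 1) − 6 (s − 4) − 2 j` with `j ≤ 6`, or at most `s (s + 1) − 8 (s − 5)`. -/
theorem pair_count_spectrum_three (H : SimpleGraph V) [DecidableRel H.Adj] (hfree : H.CliqueFree 3) (s : ℕ)
    (hs : 15 ≤ s) (hm : H.edgeFinset.card = s) :
    ∑ v, deg H v * deg H v = s * (s + 1) ∨
      (∃ j, j ≤ 1 ∧ ∑ v, deg H v * deg H v + 2 * (s - 2) + 2 * j = s * (s + 1)) ∨
      (∃ j, j ≤ 3 ∧ ∑ v, deg H v * deg H v + 4 * (s - 3) + 2 * j = s * (s + 1)) ∨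
      (∃ j, j ≤ 6 ∧ ∑ v, deg H v * deg H v + 6 * (s - 4) + 2 * j = s * (s + 1)) ∨
      ∑ v, deg H v * deg H v + 8 * (s - 5) ≤ s * (s + 1) := by
  obtain ⟨w, hwmax, hcard, j, hj, hlayer⟩ := pair_count_layer H hfree (by omega)
  rw [hm] at hcard hlayer
  obtain ⟨t, ht⟩ : ∃ t, (offEdges H w).card = t := ⟨_, rfl⟩
  rw [ht] at hcard hj hlayer
  by_cases ht3 : t ≤ 3
  · interval_cases t
    · left
      have e : deg H w - 1 + 1 = deg H w := by omega
      simp only [zero_mul, mul_zero, add_zero] at hlayer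
      have : j = 0 := by omega
      rw [this] at hlayer
      simpa using hlayer
    · right; left
      refine ⟨j, by omega, ?_⟩
      have e : deg H w - 1 = s - 2 := by omega
      rw [e, one_mul] at hlayer
      exact hlayer
    · right; right; left
      refine ⟨j, by omega, ?_⟩
      have e : 2 * (deg H w - 1) = 2 * (s - 3) := by omega
      rw [e, ← mul_assoc] at hlayer
      exact hlayer
    · right; right; right; left
      refine ⟨j, by omega, ?_⟩
      have e : 3 * (deg H w - 1) = 3 * (s - 4) := by omega
      rw [e, ← mul_assoc] at hlayer
      exact hlayer
  · right; right; right; right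
    have hΔ : ∀ v, deg H v + 3 + 1 ≤ H.edgeFinset.card := fun v => by
      have := hwmax v
      omega
    have := sum_deg_sq_le_of_maxdeg_level H hfree 3 (by omega) hΔ
    rw [hm] at this
    have e : 2 * ((3 + 1) * (s - 3 - 2)) = 8 * (s - 5) := by omega
    rw [e] at this
    exact this

end C047

end TriangleCap

end PercRepro
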